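import Literature.NumberTheory.Automorphic.BookerStrongArtin
import Literature.NumberTheory.Automorphic.ArtinLFunctions
import Literature.NumberTheory.GaloisRepresentations.FramedRepTwistEulerFactorProofs
import Literature.NumberTheory.GaloisRepresentations.ArtinDirichletCoefficients
import Literature.NumberTheory.GaloisRepresentations.ArtinLFunctionOffStripProofs
import Literature.NumberTheory.LFunctions.AdditiveTwistProofs
import Mathlib.NumberTheory.LSeries.Injectivity
import HarnessLib

/-!
# Booker 2003, Lemma 1: additive twists of `L(s, ρ)` are meromorphic with poles only in the
# critical strip — the assembly (pure proofs; theorems only)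

A. R. Booker, *Poles of Artin L-functions and the strong Artin conjecture*, Ann. of Math. 158
(2003), Lemma 1 (p. 1092) with its proof (pp. 1092–1093), vendored as the named fact
`Literature.NumberTheory.Automorphic.booker_additiveTwist_meromorphic` (`Automorphic/BookerStrongArtin`):
for an irreducible even `σ : Γ_ℚ → GL₂(ℂ)` with Dirichlet coefficients `a`
(`∑ aₙ n^{-s} = L(s, σ)` on `Re s > 1`) and every rational `α`, the additive twist
`∑ aₙ e(nα) n^{-s}` agrees on `Re s > 1` with a function meromorphic on `ℂ` and analytic at every
`s` with `Re s ≤ 0` or `Re s ≥ 1`.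

The printed proof has an ALGEBRAIC half — the twisted series lies in the span `V` of the
`q^{-s} L(s, σ ⊗ χ₀)` (CRT, the recursion (6)–(8), Fourier analysis on `(ℤ/p^j)ˣ`), proved in the
tree on coefficient sequences (`LFunctions/AdditiveTwistProofs`,
`LSeries.exists_addTwist_eq_sum_charTwist`: `∑ aₙ e(nx) n^{-s} = ∑ᵢ cᵢ qᵢ^{-s} ∑ₙ aₙ χᵢ(n) n^{-s}`
with Dirichlet characters `χᵢ mod Mᵢ`, possibly imprimitive) — and an ANALYTIC half, the input
(p. 1091) that every `L(s, σ ⊗ χ)` "is holomorphic in `Re(s) ≥ 1`, and by the functional equation,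
in `Re(s) ≤ 0`".  This file supplies the bridge and the analytic half:

* `exists_entire_LSeries_dirichletCoeff_mul_dirichlet_eq` (**the naive character twist is the twisted Artin
  L-function up to finitely many Euler factors**): for `σ : Γ_ℚ → GL_n(ℂ)`, `a = dirichletCoeff σ`
  and a Dirichlet character `χ mod M` (`M ≥ 1`),
  `∑ₙ aₙ χ(n) n^{-s} = C(s) · L(s, σ ⊗ χ)` on `Re s > 1` with `C(s) = ∏_{p ∣ M} L_p(σ ⊗ χ, p^{-s})`
  ENTIRE — Euler products on both sides (Mathlib `EulerProduct.eulerProduct_hasProd`), the local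
  factors agreeing at `p ∤ M` by the tree's `FramedRep.eval_eulerFactorAt_of_twist_dirichlet`
  (`L_p(σ ⊗ χ, T) = L_p(σ, χ(p) T)`, file `FramedRepTwistEulerFactorProofs`, whose convention
  "`π` with `π(g) = χ(g) · σ(g)`" for the twist is followed here) and being `1` on the left at
  `p ∣ M` (`χ(p) = 0`);
* `exists_offStrip_continuation_LSeries_dirichletCoeff_mul_dirichlet` — hence, granting Artin's
  functional equation over `ℚ` (`Automorphic.artin_functional_equation (K := ℚ)`, Neukirch VII
  (12.6), a named fact of the tree taken as a hypothesis), each `∑ aₙ χ(n) n^{-s}` for irreducible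
  `σ` of rank `2` continues meromorphically to `ℂ` with no pole off the critical strip
  (`FramedArtinRep.exists_meromorphic_offStrip_of_isIrreducible` for the irreducible
  `σ ⊗ χ`, `FramedRep.exists_twist`, `FramedRep.isIrreducible_of_twist`);
* `booker_additiveTwist_meromorphic_of_artin_functional_equation` — **Booker's Lemma 1 from
  Artin's functional equation**: `artin_functional_equation (K := ℚ) → booker_additiveTwist_meromorphic`.
  The given coefficient sequence `a` of the fact is identified with `dirichletCoeff σ` at every
  `n ≥ 1` by the injectivity of the Dirichlet transform (Mathlib
  `LSeries.eq_of_LSeries_eventually_eq`; `L(s, σ) ≠ 0` on `Re s > 1` rules out a divergent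
  series); the evenness hypothesis of the fact is not used (as in print, where it only fixes the
  `Γ`-factor of the section).

The unconditional `booker_additiveTwist_meromorphic_holds` is the last theorem applied to
`artin_functional_equation_holds` once that named fact is discharged (its two leaves are tracked in
`Automorphic/ArtinLFunctionsFunctionalEquation`); nothing else is missing.

## References

* A. R. Booker, *Poles of Artin L-functions and the strong Artin conjecture*, Ann. of Math. (2)
  158 (2003), 1089–1098: eq. (4) p. 1091, the paragraph before Lemma 1 (p. 1091), Lemma 1 and its
  proof (pp. 1092–1093). [Booker2003]
* J. Neukirch, *Algebraic Number Theory* (1999), VII §10 (10.1), §12 Thm. (12.6). [NeukirchANT1999]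

## Mathlib / tree search

Tree: `booker_additiveTwist_meromorphic` (the fact), `LSeries.exists_addTwist_eq_sum_charTwist`,
`LSeries.lseriesSummable_mul_dirichlet` (`LFunctions/AdditiveTwistProofs`),
`ArtinRep.dirichletCoeff`, `ArtinRep.LSeries_dirichletCoeff_eq_artinLFunction`,
`ArtinRep.tsum_localCoeff_mul_pow`, `ArtinRep.term_dirichletCoeff_mul_of_coprime`
(`GaloisRepresentations/ArtinDirichletCoefficients`), `FramedRep.exists_twist`,
`FramedRep.eval_eulerFactorAt_of_twist_dirichlet`, `FramedRep.isIrreducible_of_twist`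
(`GaloisRepresentations/FramedRepTwistEulerFactorProofs`),
`FramedArtinRep.exists_meromorphic_offStrip_of_isIrreducible`
(`GaloisRepresentations/ArtinLFunctionOffStripProofs`), `artinLFunction_ne_zero_of_one_lt_re`.
Mathlib: `EulerProduct.eulerProduct_hasProd`, `HasProd.mul`, `hasProd_prod_of_ne_finset_one`,
`LSeries.eq_of_LSeries_eventually_eq`, `DirichletCharacter.norm_le_one`, `MulChar.map_nonunit`.
No definition and no named fact is introduced (D-0026).
-/

noncomputable section

open scoped NumberField
open Field IsDedekindDomain Module NumberField Polynomial Complex Filter Set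
open Rat.HeightOneSpectrum
open Literature.NumberTheory.GaloisRepresentations Literature.NumberTheory.LFunctions

namespace Literature.NumberTheory.Automorphic

namespace Booker2003

variable {n : ℕ}

/-! ### The naive character twist of the Dirichlet coefficients -/

section CharTwist

variable (σ : FramedArtinRep ℚ n) {M : ℕ} [NeZero M] (χ : DirichletCharacter ℂ M)
  {π : FramedArtinRep ℚ n}

/-- The twisted representation `σ ⊗ χ`, through the tree's convention
(`FramedRepTwistEulerFactorProofs`): any `π` with `π(g) = χ(g) · σ(g)` (such `π` exist,
`FramedRep.exists_twist`). -/
local notation "σχ" => FramedArtinRep.toArtinRep π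

omit [NeZero M] in
/-- The summands `aₙ χ(n) n^{-s}` are multiplicative on coprime arguments and `= 1` at `n = 1`.
[folklore] -/
theorem term_dirichletCoeff_mul_dirichlet_mul_of_coprime (s : ℂ) :
    LSeries.term ((ArtinRep.dirichletCoeff σ.toArtinRep) * fun m : ℕ => χ (m : ZMod M)) s 1 = 1 ∧
      ∀ {k l : ℕ}, k.Coprime l →
        LSeries.term ((ArtinRep.dirichletCoeff σ.toArtinRep) * fun m : ℕ => χ (m : ZMod M)) s (k * l) =
          LSeries.term ((ArtinRep.dirichletCoeff σ.toArtinRep) * fun m : ℕ => χ (m : ZMod M)) s k *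
            LSeries.term ((ArtinRep.dirichletCoeff σ.toArtinRep) * fun m : ℕ => χ (m : ZMod M)) s l := by
  refine ⟨by rw [LSeries.term_of_ne_zero one_ne_zero, Pi.mul_apply, ArtinRep.dirichletCoeff_one,
    Nat.cast_one, Nat.cast_one, map_one, one_cpow, mul_one, div_one], fun {k l} hkl => ?_⟩
  rcases eq_or_ne k 0 with rfl | hk
  · simp [LSeries.term_zero]
  rcases eq_or_ne l 0 with rfl | hl
  · simp [LSeries.term_zero]
  rw [LSeries.term_of_ne_zero (mul_ne_zero hk hl), LSeries.term_of_ne_zero hk,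
    LSeries.term_of_ne_zero hl, Pi.mul_apply, Pi.mul_apply, Pi.mul_apply,
    ArtinRep.dirichletCoeff_mul_of_coprime _ hkl, Nat.cast_mul, Nat.cast_mul, map_mul,
    Complex.natCast_mul_natCast_cpow]
  ring

/-- The local series of the naive twist at a prime `p ∤ M`:
`∑_k a_{p^k} χ(p^k) p^{-ks} = L_p(σ ⊗ χ, p^{-s})⁻¹` for `Re s > 1`. [cite: Booker2003, proof of Lemma 1 (p. 1093)] -/
theorem tsum_term_dirichletCoeff_mul_dirichlet_prime_pow_of_not_dvd
    (hπ : ∀ g, π g = Matrix.GeneralLinearGroup.scalar (Fin n) (dirichletGaloisCharacter ℚ χ g) * σ g)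
    {s : ℂ} (hs : 1 < s.re) (p : Nat.Primes) (hp : ¬ (p : ℕ) ∣ M) :
    ∑' k : ℕ, LSeries.term ((ArtinRep.dirichletCoeff σ.toArtinRep) * fun m : ℕ => χ (m : ZMod M)) s
        ((p : ℕ) ^ k) =
      ((ArtinRep.eulerFactorAt σχ ((primesEquiv (R := 𝓞 ℚ)).symm p)).eval (((p : ℕ) : ℂ) ^ (-s)))⁻¹ := by
  have hpp : (p : ℕ).Prime := p.2
  have hvp : (primesEquiv (R := 𝓞 ℚ)) ((primesEquiv (R := 𝓞 ℚ)).symm p) = p :=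
    Equiv.apply_symm_apply _ p
  have hv' : ¬ (((primesEquiv (R := 𝓞 ℚ)) ((primesEquiv (R := 𝓞 ℚ)).symm p) : Nat.Primes) : ℕ) ∣ M := by
    rwa [hvp]
  have hz : ‖χ ((p : ℕ) : ZMod M) * ((p : ℕ) : ℂ) ^ (-s)‖ < 1 := by
    rw [norm_mul, Complex.norm_natCast_cpow_of_pos hpp.pos, Complex.neg_re]
    calc ‖χ ((p : ℕ) : ZMod M)‖ * ((p : ℕ) : ℝ) ^ (-s.re) ≤ 1 * ((p : ℕ) : ℝ) ^ (-s.re) := by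
          gcongr
          exact DirichletCharacter.norm_le_one χ _
      _ < 1 := by
          rw [one_mul]
          exact Real.rpow_lt_one_of_one_lt_of_neg (by exact_mod_cast hpp.one_lt) (by linarith)
  rw [FramedRep.eval_eulerFactorAt_of_twist_dirichlet χ hπ hv', hvp,
    ← ArtinRep.tsum_localCoeff_mul_pow σ.toArtinRep _ hz]
  refine tsum_congr fun k => ?_
  rw [LSeries.term_of_ne_zero (pow_ne_zero k hpp.ne_zero), Pi.mul_apply,
    ArtinRep.dirichletCoeff_prime_pow _ hpp k, show (⟨(p : ℕ), hpp⟩ : Nat.Primes) = p from rfl,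
    Nat.cast_pow, Nat.cast_pow, map_pow, div_eq_mul_inv, ← Complex.cpow_neg,
    ← Complex.natCast_cpow_natCast_mul, Complex.cpow_nat_mul, mul_pow]
  ring

omit [NeZero M] in
/-- The local series of the naive twist at a prime `p ∣ M` is `1` (`χ(p^k) = 0` for `k ≥ 1`).
[cite: Booker2003, proof of Lemma 1 (p. 1093)] -/
theorem tsum_term_dirichletCoeff_mul_dirichlet_prime_pow_of_dvd (s : ℂ) (p : Nat.Primes)
    (hp : (p : ℕ) ∣ M) :
    ∑' k : ℕ, LSeries.term ((ArtinRep.dirichletCoeff σ.toArtinRep) * fun m : ℕ => χ (m : ZMod M)) s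
        ((p : ℕ) ^ k) = 1 := by
  have hpp : (p : ℕ).Prime := p.2
  have hχp : χ ((p : ℕ) : ZMod M) = 0 :=
    MulChar.map_nonunit χ fun hu =>
      (hpp.coprime_iff_not_dvd.mp ((ZMod.isUnit_iff_coprime _ _).mp hu)) hp
  rw [tsum_eq_single 0]
  · rw [pow_zero, LSeries.term_of_ne_zero one_ne_zero, Pi.mul_apply, ArtinRep.dirichletCoeff_one,
      Nat.cast_one, Nat.cast_one, map_one, one_cpow, mul_one, div_one]
  · intro k hk
    rw [LSeries.term_of_ne_zero (pow_ne_zero k hpp.ne_zero), Pi.mul_apply, Nat.cast_pow, map_pow,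
      hχp, zero_pow hk, mul_zero, zero_div]

/-- **The naive character twist of the Dirichlet coefficients is the twisted Artin L-function up
to finitely many Euler factors** (Booker 2003, proof of Lemma 1, p. 1093: the series
`∑_{(r,p)=1} a_r χ(r) r^{-s}` "is `L(s, ρ ⊗ χ₀ ⊗ χ)` with the Euler factor at `p` removed … these
factors are polynomials in `p^{-s}`").  For `σ : Γ_ℚ → GL_n(ℂ)` with Dirichlet coefficients
`a = dirichletCoeff σ` and a Dirichlet character `χ mod M`, `M ≥ 1` (possibly imprimitive), there
is an ENTIRE `C` (namely `C(s) = ∏_{p ∣ M} L_p(σ ⊗ χ, p^{-s})`) with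
`∑ₙ aₙ χ(n) n^{-s} = C(s) · L(s, σ ⊗ χ)` for `Re s > 1`, where `σ ⊗ χ` is any `π` with
`π(g) = χ(g) · σ(g)`, `χ` viewed as the character of `Γ_ℚ` attached to it
(`dirichletGaloisCharacter`).  Both sides are Euler products; at `p ∤ M` the local factors agree
(`L_p(σ ⊗ χ, T) = L_p(σ, χ(p) T)`, `FramedRep.eval_eulerFactorAt_of_twist_dirichlet`), at `p ∣ M`
the left factor is `1`.
[cite: Booker2003, proof of Lemma 1 (p. 1093)] [cite: NeukirchANT1999, VII §10 (10.1)] -/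
theorem exists_entire_LSeries_dirichletCoeff_mul_dirichlet_eq
    (hπ : ∀ g, π g = Matrix.GeneralLinearGroup.scalar (Fin n) (dirichletGaloisCharacter ℚ χ g) * σ g) :
    ∃ C : ℂ → ℂ, Differentiable ℂ C ∧ ∀ s : ℂ, 1 < s.re →
      LSeries ((ArtinRep.dirichletCoeff σ.toArtinRep) * fun m : ℕ => χ (m : ZMod M)) s =
        C s * artinLFunction σχ s := by
  classical
  -- the finite set of primes dividing `M`, as a finset of the subtype of primes
  set S : Finset {p : ℕ // p.Prime} := (M.primeFactors).subtype Nat.Prime with hS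
  have hSmem : ∀ p : {p : ℕ // p.Prime}, p ∈ S ↔ (p : ℕ) ∣ M := fun p => by
    rw [hS, Finset.mem_subtype, Nat.mem_primeFactors]
    exact ⟨fun h => h.2.1, fun h => ⟨p.2, h, NeZero.ne M⟩⟩
  -- the correction factor
  set corr : Nat.Primes → ℂ → ℂ := fun p s =>
    (ArtinRep.eulerFactorAt σχ ((primesEquiv (R := 𝓞 ℚ)).symm p)).eval (((p : ℕ) : ℂ) ^ (-s))
    with hcorr
  have hcorrd : ∀ p : Nat.Primes, Differentiable ℂ (corr p) := fun p => by
    have hin : Differentiable ℂ fun s : ℂ => ((p : ℕ) : ℂ) ^ (-s) :=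
      differentiable_id.neg.const_cpow (Or.inl (Nat.cast_ne_zero.mpr p.2.ne_zero))
    exact (ArtinRep.eulerFactorAt σχ ((primesEquiv (R := 𝓞 ℚ)).symm p)).differentiable.comp hin
  refine ⟨fun s => ∏ p ∈ S, corr p s, Differentiable.fun_finsetProd fun p _ => hcorrd p,
    fun s hs => ?_⟩
  -- Euler product of the left-hand side
  set b : ℕ → ℂ := (ArtinRep.dirichletCoeff σ.toArtinRep) * fun m : ℕ => χ (m : ZMod M) with hb
  have hbsum : Summable fun m => ‖LSeries.term b s m‖ :=
    summable_norm_iff.mpr (LSeries.lseriesSummable_mul_dirichlet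
      (σ.toArtinRep.LSeriesSummable_dirichletCoeff hs) χ)
  obtain ⟨h1, hmul⟩ := term_dirichletCoeff_mul_dirichlet_mul_of_coprime σ χ s
  have hEP := EulerProduct.eulerProduct_hasProd h1 hmul hbsum (LSeries.term_zero _ _)
  -- Euler product of `L(s, σ ⊗ χ)`
  set f : Nat.Primes → ℂ := fun p =>
    ((ArtinRep.eulerFactorAt σχ ((primesEquiv (R := 𝓞 ℚ)).symm p)).eval (((p : ℕ) : ℂ) ^ (-s)))⁻¹
    with hf
  obtain ⟨h1', hmul'⟩ := ArtinRep.term_dirichletCoeff_mul_of_coprime σχ s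
  have hEP' := EulerProduct.eulerProduct_hasProd h1' hmul'
    (summable_norm_iff.mpr (ArtinRep.LSeriesSummable_dirichletCoeff σχ hs)) (LSeries.term_zero _ _)
  have hEPf : HasProd f (artinLFunction σχ s) := by
    rw [← ArtinRep.LSeries_dirichletCoeff_eq_artinLFunction σχ hs, LSeries]
    refine hEP'.congr_fun fun p => ?_
    rw [hf, ArtinRep.tsum_term_prime_pow_eq σχ hs p]
  -- the finitely supported correction
  set g : Nat.Primes → ℂ := fun p => if (p : ℕ) ∣ M then corr p s else 1 with hg
  have hgS : ∀ p ∉ S, g p = 1 := fun p hp => by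
    rw [hg]
    exact if_neg (fun h => hp ((hSmem p).mpr h))
  have hgprod : HasProd g (∏ p ∈ S, corr p s) := by
    have h : ∏ p ∈ S, corr p s = ∏ p ∈ S, g p :=
      Finset.prod_congr rfl fun p hp => by rw [hg]; exact (if_pos ((hSmem p).mp hp)).symm
    rw [h]
    exact hasProd_prod_of_ne_finset_one hgS
  -- compare local factors
  have hloc : ∀ p : Nat.Primes, ∑' k : ℕ, LSeries.term b s ((p : ℕ) ^ k) = g p * f p := by
    intro p
    by_cases hpM : (p : ℕ) ∣ M
    · have hgp : g p = corr p s := if_pos hpM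
      rw [hb, tsum_term_dirichletCoeff_mul_dirichlet_prime_pow_of_dvd σ χ s p hpM, hgp, hcorr, hf,
        mul_inv_cancel₀]
      refine ArtinRep.eval_eulerFactorAt_ne_zero_of_norm_lt_one σχ _ ?_
      rw [Complex.norm_natCast_cpow_of_pos p.2.pos, Complex.neg_re]
      exact Real.rpow_lt_one_of_one_lt_of_neg (by exact_mod_cast p.2.one_lt) (by linarith)
    · have hgp : g p = 1 := if_neg hpM
      rw [hb, tsum_term_dirichletCoeff_mul_dirichlet_prime_pow_of_not_dvd σ χ hπ hs p hpM, hgp, one_mul]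
  have hEP2 : HasProd (fun p : Nat.Primes => ∑' k : ℕ, LSeries.term b s ((p : ℕ) ^ k))
      ((∏ p ∈ S, corr p s) * artinLFunction σχ s) := by
    rw [show (fun p : Nat.Primes => ∑' k : ℕ, LSeries.term b s ((p : ℕ) ^ k)) = fun p => g p * f p from
      funext hloc]
    exact hgprod.mul hEPf
  rw [LSeries]
  exact hEP.unique hEP2

end CharTwist

/-! ### The analytic half: continuation of the character twists off the strip -/

/-- **Each naive character twist of `L(s, σ)` is regular off the critical strip, given Artin's
functional equation** (Booker 2003, p. 1091, for the `σ ⊗ χ`: "holomorphic in `Re(s) ≥ 1`, and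
by the functional equation, in `Re(s) ≤ 0`"; p. 1092: every element of `V` "satisfies the
conclusion of the lemma").  For irreducible `σ : Γ_ℚ → GL₂(ℂ)` and a Dirichlet character
`χ mod M`, `M ≥ 1`, granting `artin_functional_equation (K := ℚ)`: the sequence `aₙ χ(n)`
(`a = dirichletCoeff σ`) has absolutely convergent Dirichlet series on `Re s > 1`, agreeing there
with a function meromorphic at every point of `ℂ` and analytic at every `s` with `Re s ≤ 0` or
`Re s ≥ 1` — `C · D` with `C` entire (`exists_entire_LSeries_dirichletCoeff_mul_dirichlet_eq`) and
`D` the continuation of `L(s, σ ⊗ χ)` (`FramedArtinRep.exists_meromorphic_offStrip_of_isIrreducible`,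
`σ ⊗ χ` being irreducible, `FramedRep.isIrreducible_of_twist`).
[cite: Booker2003, p. 1091 and proof of Lemma 1 (p. 1092)] -/
theorem exists_offStrip_continuation_LSeries_dirichletCoeff_mul_dirichlet
    (hFE : artin_functional_equation (K := ℚ)) (σ : FramedArtinRep ℚ 2)
    (hirr : σ.toGaloisRep.IsIrreducible) {M : ℕ} [NeZero M] (χ : DirichletCharacter ℂ M) :
    (∀ s : ℂ, 1 < s.re →
      LSeriesSummable ((ArtinRep.dirichletCoeff σ.toArtinRep) * fun m : ℕ => χ (m : ZMod M)) s) ∧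
    ∃ D : ℂ → ℂ, (∀ z : ℂ, MeromorphicAt D z) ∧
      (∀ s : ℂ, s.re ≤ 0 ∨ 1 ≤ s.re → AnalyticAt ℂ D s) ∧
      ∀ s : ℂ, 1 < s.re →
        D s = LSeries ((ArtinRep.dirichletCoeff σ.toArtinRep) * fun m : ℕ => χ (m : ZMod M)) s := by
  refine ⟨fun s hs => LSeries.lseriesSummable_mul_dirichlet
    (σ.toArtinRep.LSeriesSummable_dirichletCoeff hs) χ, ?_⟩
  obtain ⟨τ, hτ⟩ : ∃ τ : FramedArtinRep ℚ 2, ∀ g, τ g =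
      Matrix.GeneralLinearGroup.scalar (Fin 2) (dirichletGaloisCharacter ℚ χ g) * σ g :=
    FramedRep.exists_twist σ (dirichletGaloisCharacter ℚ χ)
  obtain ⟨D, hDm, hDa, hDL⟩ :=
    FramedArtinRep.exists_meromorphic_offStrip_of_isIrreducible τ
      (FramedRep.isIrreducible_of_twist hτ hirr) one_lt_two (hFE τ)
  obtain ⟨C, hC, hCL⟩ := exists_entire_LSeries_dirichletCoeff_mul_dirichlet_eq σ χ hτ
  refine ⟨fun s => C s * D s, fun z => (hC.analyticAt z).meromorphicAt.mul (hDm z),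
    fun s hs => (hC.analyticAt s).mul (hDa s hs), fun s hs => ?_⟩
  show C s * D s = _
  rw [hDL s hs, hCL s hs]

/-! ### Identification of the coefficient sequence of the fact -/

/-- **A sequence whose Dirichlet series is `L(s, σ)` on `Re s > 1` is the sequence of Dirichlet
coefficients of `σ` at every `n ≥ 1`**: `L(2, σ) ≠ 0` forces the series to converge absolutely at
`s = 2` (a divergent `LSeries` has junk value `0`), and two Dirichlet series converging somewhere
and agreeing on large real `s` have the same coefficients (Mathlib
`LSeries.eq_of_LSeries_eventually_eq`). [folklore] -/
theorem eq_dirichletCoeff_of_LSeries_eq_artinLFunction (σ : FramedArtinRep ℚ n) {a : ℕ → ℂ}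
    (ha : ∀ s : ℂ, 1 < s.re → LSeries a s = artinLFunction σ.toArtinRep s) {m : ℕ} (hm : m ≠ 0) :
    a m = ArtinRep.dirichletCoeff σ.toArtinRep m := by
  have h2 : (1 : ℝ) < (2 : ℂ).re := by norm_num
  -- absolute convergence of `a` at `s = 2`
  have hsum : LSeriesSummable a 2 := by
    by_contra h
    have h0 := LSeries.eq_zero_of_not_LSeriesSummable a 2
    rw [ha 2 h2] at h0
    exact artinLFunction_ne_zero_of_one_lt_re σ.toArtinRep h2 (h0 h)
  have habs : LSeries.abscissaOfAbsConv a < ⊤ :=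
    lt_of_le_of_lt hsum.abscissaOfAbsConv_le (EReal.coe_lt_top _)
  have habs' : LSeries.abscissaOfAbsConv (ArtinRep.dirichletCoeff σ.toArtinRep) < ⊤ :=
    lt_of_le_of_lt (σ.toArtinRep.LSeriesSummable_dirichletCoeff h2).abscissaOfAbsConv_le
      (EReal.coe_lt_top _)
  refine LSeries.eq_of_LSeries_eventually_eq habs habs' ?_ hm
  filter_upwards [Filter.eventually_gt_atTop (1 : ℝ)] with x hx
  have hx' : 1 < (x : ℂ).re := by rwa [Complex.ofReal_re]
  rw [ha x hx', ArtinRep.LSeries_dirichletCoeff_eq_artinLFunction σ.toArtinRep hx']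

/-! ### Booker's Lemma 1 from Artin's functional equation -/

/-- **Booker 2003, Lemma 1, from Artin's functional equation.**  Granting the named fact
`artin_functional_equation` over `ℚ` (Neukirch VII (12.6): meromorphic continuation and functional
equation `Λ(1 - s, ρ) = W Λ(s, ρ^∨)` for every `ρ : Γ_ℚ → GL_n(ℂ)`), the named fact
`booker_additiveTwist_meromorphic` holds: for an irreducible (even) `σ : Γ_ℚ → GL₂(ℂ)` with
Dirichlet coefficients `a` and every rational `α`, `∑ aₙ e(nα) n^{-s}` agrees on `Re s > 1` with a
function meromorphic on `ℂ` and analytic at every `s` with `Re s ≤ 0` or `Re s ≥ 1`.  Proof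
(Booker's): `a = dirichletCoeff σ` on `n ≥ 1` (`eq_dirichletCoeff_of_LSeries_eq_artinLFunction`);
the twisted series is a finite combination `∑ᵢ cᵢ qᵢ^{-s} ∑ₙ aₙ χᵢ(n) n^{-s}`
(`LSeries.exists_addTwist_eq_sum_charTwist`, the algebraic half); each summand continues as
required (`exists_offStrip_continuation_LSeries_dirichletCoeff_mul_dirichlet`, the analytic half),
and so does the combination.  The evenness hypothesis is not used.
[cite: Booker2003, Lemma 1 (p. 1092) and its proof (pp. 1092–1093)] -/
theorem booker_additiveTwist_meromorphic_of_artin_functional_equation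
    (hFE : artin_functional_equation (K := ℚ)) : booker_additiveTwist_meromorphic := by
  intro σ a hirr _heven ha α
  classical
  set a' : ℕ → ℂ := ArtinRep.dirichletCoeff σ.toArtinRep with ha'
  have haa' : ∀ {m : ℕ}, m ≠ 0 → a m = a' m := fun hm =>
    eq_dirichletCoeff_of_LSeries_eq_artinLFunction σ ha hm
  -- the algebraic half, for `a'`
  obtain ⟨ι, hι, c, q, M, χ, hq, hM, hsum⟩ := LSeries.exists_addTwist_eq_sum_charTwist a'
    (fun m k _ _ hmk => ArtinRep.dirichletCoeff_mul_of_coprime _ hmk) α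
  -- the analytic half, summand by summand
  haveI : ∀ i, NeZero (M i) := fun i => ⟨hM i⟩
  have hgen := fun i => exists_offStrip_continuation_LSeries_dirichletCoeff_mul_dirichlet hFE σ hirr (χ i)
  choose hsm D hDm hDa hDL using hgen
  have hqd : ∀ i, Differentiable ℂ fun s : ℂ => (q i : ℂ) ^ (-s) := fun i =>
    differentiable_id.neg.const_cpow (Or.inl (Nat.cast_ne_zero.mpr (hq i)))
  refine ⟨fun s => ∑ i, c i * (q i : ℂ) ^ (-s) * D i s, ?_, ?_, ?_⟩
  · -- meromorphic on `ℂ`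
    intro z _
    exact MeromorphicAt.fun_sum (G := fun i s => c i * (q i : ℂ) ^ (-s) * D i s) fun i _ =>
      ((MeromorphicAt.const (c i) z).mul ((hqd i).analyticAt z).meromorphicAt).mul (hDm i z)
  · -- analytic off the strip
    intro s hs
    have h : AnalyticAt ℂ (fun s => ∑ i ∈ Finset.univ, c i * (q i : ℂ) ^ (-s) * D i s) s :=
      Finset.analyticAt_fun_sum Finset.univ fun i _ =>
        (analyticAt_const.mul ((hqd i).analyticAt s)).mul (hDa i s hs)
    exact h
  · -- agreement with the twisted series on `Re s > 1`
    intro s hs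
    have hs' : LSeriesSummable a' s := σ.toArtinRep.LSeriesSummable_dirichletCoeff hs
    have htw : LSeries (fun m : ℕ => a m * Complex.exp (2 * Real.pi * Complex.I * (m : ℂ) *
        ((α : ℚ) : ℂ))) s = LSeries.addTwist a' α s := by
      rw [LSeries.addTwist_eq]
      refine LSeries_congr (fun {m} hm => ?_) s
      rw [LSeries.addTwistCoeff_apply, haa' hm]
    rw [htw, hsum s hs']
    refine Finset.sum_congr rfl fun i _ => ?_
    rw [hDL i s hs]

end Booker2003

end Literature.NumberTheory.Automorphic

end
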